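import Summits.QuantumFields.BalabanUV.Beta.FP.LegPairing

/-!
# `BalabanUV.Beta.FP.LegPairingTable` — THE PAIRING IDENTITY: `bubble A V W − Σ_{ι κ a c} F_{ικ}^{ac} · G_{ικ}^{ca} = Σ'_x Σ_a Σ'_z Σ_c E x z a c`
# (road «FP», LEGS generic Taylor-pairing track, module (P) part 2; [folklore] bookkeeping of absolutely convergent lattice sums)

HONEST DEPENDENCY (page 1, mandatory): continuum YM on T⁴ ⇐ BetaPertH ∧ nine spine estimates (0/9 proved); BetaPertH ⇐ (D1) ∧ (D4) ∧
CAP+tail; G-an2-4 gates asym, D1 and NE2/3/4.  HONEST FRAMING (cell contract, verbatim): «discharging `BetaPertH` makes Bałaban's UV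
stability UNCONDITIONAL — a real constructive-QFT result; it is NOT the continuum limit and NOT the Clay problem.»  THIS MODULE is elementary
[folklore] bookkeeping over `FP/LegPairing` ∕ `FP/StencilMoments` ∕ the tree's `ExpKernelCalculus`; it asserts nothing about Bałaban's objects, cites nothing, mints no
`Prop` fact; TWO DATA `def`s (`tableTerm`, `remTerm`: the table and remainder INTEGRANDS of the bubble's double series), 0 sorry.  NOT `hlegs`, NOT D1, NOT BetaPertH,
NOT continuum, NOT Clay.

WHAT IS HERE.  For a bounded leg `A` (`Bdd A B`), `V` bi-localised at `(q, q)`, `W` bi-localised at `(p, p)` (rate `δ > 0`):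
* §1 `bubble_eq_tsum`: `bubble A V W = Σ'_x Σ_a Σ'_z Σ_c comp A V x z a c · comp A W z x c a` (rfl); the integrand splits as `tableTerm + remTerm`
  (`integrand_split`, via `LegPairing.comp_split` in the free argument of each leg), where
  `tableTerm x z a c = Σ_ι Σ_κ (mono ι (x−p) · comp (dKer ι A) V p z a c) · (mono κ (z−q) · comp (dKer κ A) W q x c a)`,
  `remTerm x z a c = (Σ_ι mono ι (x−p) · comp (dKer ι A) V p z a c) · comp (remKer q A) W z x c a + comp (remKer p A) V x z a c · comp A W z x c a`;
* §2 bi-localisation (in `(x, z)` at `(p, q)`) of the full integrand and of `tableTerm` (polynomial weights absorbed by `StencilMoments.biLoc_weight_*`), hence of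
  `remTerm`; `dsum_add` (linearity of `Σ'_x Σ_a Σ'_z Σ_c` over bi-localised integrands);
* §3 `dsum_tableTerm`: `Σ'_x Σ_a Σ'_z Σ_c tableTerm = Σ_{ι κ a c} sLeg ι κ A V p q a c · sLeg κ ι A W q p c a` (finite sums out, the two single series factor);
* §4 **`bubble_sub_table_eq`**: `bubble A V W − Σ_{ι κ a c} sLeg ι κ A V p q a c · sLeg κ ι A W q p c a = Σ'_x Σ_a Σ'_z Σ_c remTerm x z a c`.
The `‖p − q‖⁻⁷` bound of the right-hand side from GRADED decay of `A` is module (R).  Unit `b2b-balaban-beta-d1-formalise-leaf-02` (gen 5).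
-/

noncomputable section

namespace Summit.QuantumFields.BalabanUV.Beta.FP.LegPairingTable

open Finset fwdDiff
open scoped BigOperators
open Literature.MathematicalPhysics.QuantumFieldTheory.Balaban1983to89
open Literature.MathematicalPhysics.QuantumFieldTheory.Balaban1983to89.Beta
open B12Sec2to5 (l1 l1_nonneg)
open ExpKernelCalculus (Site MKer BiLoc comp tr bubble Zl Zl_pos summable_exp_shift' tsum_exp_shift')
open KernelWard (Bdd)
open Summit.QuantumFields.BalabanUV.Beta.FP.LatticeTaylorIndex (Idx mono dOp abs_mono_le)
open Summit.QuantumFields.BalabanUV.Beta.FP.StencilMoments (biLoc_weight_snd biLoc_weight_fst summable_row abs_tsum_row_le summable_abs_tsum_row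
  summable_of_weight_exp pow_succ_mul_exp_le')
open Summit.QuantumFields.BalabanUV.Beta.FP.LegPairing (dKer remKer sLeg bdd_dKer abs_comp_bdd_biLoc_le comp_split)

variable {D : ℕ} {F : Type*} [Fintype F]

/-! ## §1 The bubble as a double series; the integrand split -/

/-- [folklore] **THE BUBBLE AS A DOUBLE SERIES** (by definition of `tr` and `comp`). -/
theorem bubble_eq_tsum (A V W : MKer D F) :
    bubble A V W = ∑' x, ∑ a, ∑' z, ∑ c, comp A V x z a c * comp A W z x c a := rfl

/-- [folklore] THE TABLE INTEGRAND: the product of the two order-two Taylor polynomials of the composed rows. -/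
def tableTerm (A V W : MKer D F) (p q : Site D) : MKer D F := fun x z a c =>
  ∑ ι : Idx D, ∑ κ : Idx D, (mono ι (x - p) * comp (dKer ι A) V p z a c) * (mono κ (z - q) * comp (dKer κ A) W q x c a)

/-- [folklore] THE REMAINDER INTEGRAND: Taylor polynomial × remainder + remainder × full row. -/
def remTerm (A V W : MKer D F) (p q : Site D) : MKer D F := fun x z a c =>
  (∑ ι : Idx D, mono ι (x - p) * comp (dKer ι A) V p z a c) * comp (remKer q A) W z x c a + comp (remKer p A) V x z a c * comp A W z x c a

/-- **THE INTEGRAND SPLITS**: `comp A V x z a c · comp A W z x c a = tableTerm + remTerm` (`comp_split` at base `p` for the first row and base `q` for the second). [folklore] -/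
theorem integrand_split {A V W : MKer D F} {B Cv Cw δ : ℝ} {p q : Site D} (hA : Bdd A B) (hV : BiLoc V q q Cv δ) (hW : BiLoc W p p Cw δ)
    (hδ : 0 < δ) (x z : Site D) (a c : F) :
    comp A V x z a c * comp A W z x c a = tableTerm A V W p q x z a c + remTerm A V W p q x z a c := by
  have h1 := comp_split hA hV hδ p x z a c
  have h2 := comp_split hA hW hδ q z x c a
  set P := ∑ ι : Idx D, mono ι (x - p) * comp (dKer ι A) V p z a c with hP
  set Q := ∑ κ : Idx D, mono κ (z - q) * comp (dKer κ A) W q x c a with hQ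
  have hPQ : P * Q = tableTerm A V W p q x z a c := by
    simp only [tableTerm, hP, hQ, Finset.sum_mul_sum]
  have e3 : P * comp A W z x c a = P * (Q + comp (remKer q A) W z x c a) := by rw [h2]
  simp only [remTerm, ← hP]
  rw [h1, add_mul, e3, ← hPQ]
  ring

/-! ## §2 Bi-localisation of the integrands; linearity of the double series -/

/-- [folklore] The double series `Σ'_x Σ_a Σ'_z Σ_c K x z a c` of a kernel in `(x, z)` with fibre `(a, c)`. -/
theorem dsum_add {K₁ K₂ : MKer D F} {p q : Site D} {C₁ C₂ δ : ℝ} (h₁ : BiLoc K₁ p q C₁ δ) (h₂ : BiLoc K₂ p q C₂ δ) (hδ : 0 < δ) :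
    ∑' x, ∑ a, ∑' z, ∑ c, (K₁ x z a c + K₂ x z a c)
      = (∑' x, ∑ a, ∑' z, ∑ c, K₁ x z a c) + ∑' x, ∑ a, ∑' z, ∑ c, K₂ x z a c := by
  -- inner linearity
  have hin : ∀ (K : MKer D F) (C : ℝ), BiLoc K p q C δ → ∀ x a, Summable fun z => ∑ c, K x z a c :=
    fun K C hK x a => summable_sum fun c _ => summable_row hK hδ x a c
  have e1 : ∀ x a, ∑' z, ∑ c, (K₁ x z a c + K₂ x z a c) = (∑' z, ∑ c, K₁ x z a c) + ∑' z, ∑ c, K₂ x z a c := by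
    intro x a
    rw [← (hin K₁ C₁ h₁ x a).tsum_add (hin K₂ C₂ h₂ x a)]
    exact tsum_congr fun z => Finset.sum_add_distrib
  -- outer summability: `|Σ'_z Σ_c K x z a c| ≤ Σ_c C·Zl·e^{−δ|x−p|}`
  have hout : ∀ (K : MKer D F) (C : ℝ), BiLoc K p q C δ → Summable fun x => ∑ a, ∑' z, ∑ c, K x z a c := by
    intro K C hK
    refine summable_sum fun a _ => ?_
    have e : (fun x => ∑' z, ∑ c, K x z a c) = fun x => ∑ c, ∑' z, K x z a c := by
      funext x; exact Summable.tsum_finsetSum fun c _ => summable_row hK hδ x a c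
    rw [e]
    exact summable_sum fun c _ => (summable_abs_tsum_row hK hδ a c).of_abs
  simp_rw [e1, Finset.sum_add_distrib]
  exact (hout K₁ C₁ h₁).tsum_add (hout K₂ C₂ h₂)

section Integrands

variable {A V W : MKer D F} {B Cv Cw δ : ℝ} {p q : Site D}

/-- [folklore] **THE FULL INTEGRAND IS BI-LOCALISED AT `(p, q)`** (bounded leg, stencils localised at `q` and `p`). -/
theorem biLoc_integrand (hA : Bdd A B) (hV : BiLoc V q q Cv δ) (hW : BiLoc W p p Cw δ) (hδ : 0 < δ) :
    BiLoc (fun x z a c => comp A V x z a c * comp A W z x c a) p q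
      (((Fintype.card F : ℝ) * (B * Cv) * Zl D δ) * ((Fintype.card F : ℝ) * (B * Cw) * Zl D δ)) δ := by
  intro x z a c
  rw [abs_mul]
  have h1 := abs_comp_bdd_biLoc_le hA hV hδ x z a c
  have h2 := abs_comp_bdd_biLoc_le hA hW hδ z x c a
  refine (mul_le_mul h1 h2 (abs_nonneg _) ((abs_nonneg _).trans h1)).trans (le_of_eq ?_)
  rw [show -δ * (l1 (x - p) + l1 (z - q)) = -δ * l1 (z - q) + -δ * l1 (x - p) by ring, Real.exp_add]
  ring

/-- [folklore] `poly × exp` pairing in one variable: `|m|≤(L+1)², |f| ≤ K e^{−δL}` ⟹ `|m|·|f| ≤ K·κ₂(δ)·e^{−(δ/2)L}`, `κ₂(δ) = 2!·e^{δ/2}·(2/δ)²`. -/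
theorem weight_pair_le {m f K δ L : ℝ} (hδ : 0 < δ) (hL : 0 ≤ L) (hK : 0 ≤ K) (hm : |m| ≤ (L + 1) ^ 2) (hf : |f| ≤ K * Real.exp (-δ * L)) :
    |m| * |f| ≤ K * ((2 : ℕ).factorial * Real.exp (δ / 2) * (2 / δ) ^ 2) * Real.exp (-(δ / 2) * L) := by
  have h1 : |m| * |f| ≤ (L + 1) ^ 2 * (K * Real.exp (-δ * L)) := mul_le_mul hm hf (abs_nonneg _) (by positivity)
  refine h1.trans ?_
  have h2 := pow_succ_mul_exp_le' 2 hδ hL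
  calc (L + 1) ^ 2 * (K * Real.exp (-δ * L)) = K * ((L + 1) ^ 2 * Real.exp (-δ * L)) := by ring
    _ ≤ K * (((2 : ℕ).factorial * Real.exp (δ / 2) * (2 / δ) ^ 2) * Real.exp (-(δ / 2) * L)) := mul_le_mul_of_nonneg_left h2 hK
    _ = _ := by ring

/-- [folklore] One table term `(mono ι (x−p)·(dKer ι A ∘ V)(p,z)) · (mono κ (z−q)·(dKer κ A ∘ W)(q,x))` is bi-localised at `(p, q)` with rate `δ/2`. -/
theorem biLoc_tableTerm_one (hA : Bdd A B) (hV : BiLoc V q q Cv δ) (hW : BiLoc W p p Cw δ) (hδ : 0 < δ) (ι κ : Idx D) :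
    BiLoc (fun x z a c => (mono ι (x - p) * comp (dKer ι A) V p z a c) * (mono κ (z - q) * comp (dKer κ A) W q x c a)) p q
      ((((Fintype.card F : ℝ) * (4 * B * Cw) * Zl D δ) * ((2 : ℕ).factorial * Real.exp (δ / 2) * (2 / δ) ^ 2))
        * (((Fintype.card F : ℝ) * (4 * B * Cv) * Zl D δ) * ((2 : ℕ).factorial * Real.exp (δ / 2) * (2 / δ) ^ 2))) (δ / 2) := by
  intro x z a c
  have hB : 0 ≤ B := (abs_nonneg _).trans (hA p q a c)
  have hCv : 0 ≤ Cv := hV.nonneg a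
  have hCw : 0 ≤ Cw := hW.nonneg a
  have hZ : 0 ≤ Zl D δ := (Zl_pos hδ).le
  have hQ : |comp (dKer κ A) W q x c a| ≤ (Fintype.card F : ℝ) * (4 * B * Cw) * Zl D δ * Real.exp (-δ * l1 (x - p)) := by
    have := abs_comp_bdd_biLoc_le (bdd_dKer κ hA) hW hδ q x c a; simpa only [mul_assoc] using this
  have hP : |comp (dKer ι A) V p z a c| ≤ (Fintype.card F : ℝ) * (4 * B * Cv) * Zl D δ * Real.exp (-δ * l1 (z - q)) := by
    have := abs_comp_bdd_biLoc_le (bdd_dKer ι hA) hV hδ p z a c; simpa only [mul_assoc] using this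
  have hx := weight_pair_le hδ (l1_nonneg (x - p)) (by positivity) (abs_mono_le ι (x - p)) hQ
  have hz := weight_pair_le hδ (l1_nonneg (z - q)) (by positivity) (abs_mono_le κ (z - q)) hP
  have e : |(mono ι (x - p) * comp (dKer ι A) V p z a c) * (mono κ (z - q) * comp (dKer κ A) W q x c a)|
      = (|mono ι (x - p)| * |comp (dKer κ A) W q x c a|) * (|mono κ (z - q)| * |comp (dKer ι A) V p z a c|) := by
    rw [abs_mul, abs_mul, abs_mul]; ring
  rw [e]
  refine (mul_le_mul hx hz (by positivity) (by positivity)).trans (le_of_eq ?_)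
  rw [show -(δ / 2) * (l1 (x - p) + l1 (z - q)) = -(δ / 2) * l1 (x - p) + -(δ / 2) * l1 (z - q) by ring, Real.exp_add]
  ring


omit [Fintype F] in
/-- [folklore] Finite sums of kernels bi-localised at the same points and rate are bi-localised (constants add). -/
theorem biLoc_finset_sum {ι' : Type*} (s : Finset ι') {K : ι' → MKer D F} {p q : Site D} {C : ι' → ℝ} {δ : ℝ}
    (h : ∀ i ∈ s, BiLoc (K i) p q (C i) δ) : BiLoc (fun x z a c => ∑ i ∈ s, K i x z a c) p q (∑ i ∈ s, C i) δ := by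
  intro x z a c
  calc |∑ i ∈ s, K i x z a c| ≤ ∑ i ∈ s, |K i x z a c| := abs_sum_le_sum_abs _ _
    _ ≤ ∑ i ∈ s, C i * Real.exp (-δ * (l1 (x - p) + l1 (z - q))) := Finset.sum_le_sum fun i hi => h i hi x z a c
    _ = (∑ i ∈ s, C i) * Real.exp (-δ * (l1 (x - p) + l1 (z - q))) := by rw [Finset.sum_mul]

/-- [folklore] **THE TABLE INTEGRAND IS BI-LOCALISED AT `(p, q)`** (rate `δ/2`; constant = `|Idx|²` × the one-term constant). -/
theorem biLoc_tableTerm (hA : Bdd A B) (hV : BiLoc V q q Cv δ) (hW : BiLoc W p p Cw δ) (hδ : 0 < δ) :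
    BiLoc (tableTerm A V W p q) p q
      (∑ _ι : Idx D, ∑ _κ : Idx D,
        (((Fintype.card F : ℝ) * (4 * B * Cw) * Zl D δ) * ((2 : ℕ).factorial * Real.exp (δ / 2) * (2 / δ) ^ 2))
          * (((Fintype.card F : ℝ) * (4 * B * Cv) * Zl D δ) * ((2 : ℕ).factorial * Real.exp (δ / 2) * (2 / δ) ^ 2))) (δ / 2) := by
  have h := biLoc_finset_sum (Finset.univ : Finset (Idx D)) (fun ι _ =>
    biLoc_finset_sum (Finset.univ : Finset (Idx D)) (fun κ _ => biLoc_tableTerm_one hA hV hW hδ ι κ))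
  intro x z a c
  simpa only [tableTerm] using h x z a c

/-- [folklore] Lowering the rate of the full integrand to `δ/2`. -/
theorem biLoc_integrand_half (hA : Bdd A B) (hV : BiLoc V q q Cv δ) (hW : BiLoc W p p Cw δ) (hδ : 0 < δ) :
    BiLoc (fun x z a c => comp A V x z a c * comp A W z x c a) p q
      (((Fintype.card F : ℝ) * (B * Cv) * Zl D δ) * ((Fintype.card F : ℝ) * (B * Cw) * Zl D δ)) (δ / 2) := by
  intro x z a c
  refine (biLoc_integrand hA hV hW hδ x z a c).trans ?_
  have hB : 0 ≤ B := (abs_nonneg _).trans (hA p q a c)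
  have hCv : 0 ≤ Cv := hV.nonneg a
  have hCw : 0 ≤ Cw := hW.nonneg a
  have hZ : 0 ≤ Zl D δ := (Zl_pos hδ).le
  have : Real.exp (-δ * (l1 (x - p) + l1 (z - q))) ≤ Real.exp (-(δ / 2) * (l1 (x - p) + l1 (z - q))) :=
    Real.exp_le_exp.mpr (by nlinarith [l1_nonneg (x - p), l1_nonneg (z - q)])
  exact mul_le_mul_of_nonneg_left this (by positivity)

/-- [folklore] **THE REMAINDER INTEGRAND IS BI-LOCALISED AT `(p, q)`** (rate `δ/2`): `remTerm = integrand − tableTerm` pointwise. -/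
theorem biLoc_remTerm (hA : Bdd A B) (hV : BiLoc V q q Cv δ) (hW : BiLoc W p p Cw δ) (hδ : 0 < δ) :
    BiLoc (remTerm A V W p q) p q
      ((((Fintype.card F : ℝ) * (B * Cv) * Zl D δ) * ((Fintype.card F : ℝ) * (B * Cw) * Zl D δ))
        + ∑ _ι : Idx D, ∑ _κ : Idx D,
          (((Fintype.card F : ℝ) * (4 * B * Cw) * Zl D δ) * ((2 : ℕ).factorial * Real.exp (δ / 2) * (2 / δ) ^ 2))
            * (((Fintype.card F : ℝ) * (4 * B * Cv) * Zl D δ) * ((2 : ℕ).factorial * Real.exp (δ / 2) * (2 / δ) ^ 2))) (δ / 2) := by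
  intro x z a c
  have e : remTerm A V W p q x z a c = comp A V x z a c * comp A W z x c a - tableTerm A V W p q x z a c := by
    rw [integrand_split hA hV hW hδ x z a c]; ring
  rw [e, add_mul]
  exact (abs_sub _ _).trans (add_le_add (biLoc_integrand_half hA hV hW hδ x z a c) (biLoc_tableTerm hA hV hW hδ x z a c))

/-! ## §3 The table part factorises into the finite bilinear form of smeared difference legs -/

/-- [folklore] One `z`-series of the table integrand: `Σ'_z (m_ι(x−p) P_ι(z)) (m_κ(z−q) Q_κ(x)) = m_ι(x−p)·Q_κ(x)·sLeg ι κ A V p q a c`. -/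
theorem tsum_tableOne_z (ι κ : Idx D) (x : Site D) (a c : F) :
    ∑' z, (mono ι (x - p) * comp (dKer ι A) V p z a c) * (mono κ (z - q) * comp (dKer κ A) W q x c a)
      = mono ι (x - p) * comp (dKer κ A) W q x c a * sLeg ι κ A V p q a c := by
  unfold sLeg
  rw [← tsum_mul_left]
  exact tsum_congr fun z => by ring

/-- [folklore] Summability in `z` of one table term (it is bi-localised, `biLoc_tableTerm_one`). -/
theorem summable_tableOne_z (hA : Bdd A B) (hV : BiLoc V q q Cv δ) (hW : BiLoc W p p Cw δ) (hδ : 0 < δ) (ι κ : Idx D) (x : Site D)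
    (a c : F) : Summable fun z => (mono ι (x - p) * comp (dKer ι A) V p z a c) * (mono κ (z - q) * comp (dKer κ A) W q x c a) :=
  summable_row (biLoc_tableTerm_one hA hV hW hδ ι κ) (by positivity) x a c

/-- [folklore] Summability in `x` of the weighted second leg, and its series = the transposed smeared leg `sLeg κ ι A W q p c a`. -/
theorem summable_legW_x (hA : Bdd A B) (hW : BiLoc W p p Cw δ) (hδ : 0 < δ) (ι κ : Idx D) (c a : F) :
    Summable fun x => mono ι (x - p) * comp (dKer κ A) W q x c a := by
  have hB : 0 ≤ B := (abs_nonneg _).trans (hA p p c a)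
  have hCw : 0 ≤ Cw := hW.nonneg a
  refine (summable_of_weight_exp (q := p) (k := 2) hδ (show 0 ≤ (Fintype.card F : ℝ) * (4 * B * Cw) * Zl D δ by
    have := (Zl_pos (D := D) hδ).le; positivity) (fun x => ?_)).1
  rw [abs_mul]
  have hQ : |comp (dKer κ A) W q x c a| ≤ (Fintype.card F : ℝ) * (4 * B * Cw) * Zl D δ * Real.exp (-δ * l1 (x - p)) := by
    have := abs_comp_bdd_biLoc_le (bdd_dKer κ hA) hW hδ q x c a; simpa only [mul_assoc] using this
  calc |mono ι (x - p)| * |comp (dKer κ A) W q x c a|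
      ≤ (l1 (x - p) + 1) ^ 2 * ((Fintype.card F : ℝ) * (4 * B * Cw) * Zl D δ * Real.exp (-δ * l1 (x - p))) :=
        mul_le_mul (abs_mono_le ι (x - p)) hQ (abs_nonneg _) (by positivity)
    _ = (Fintype.card F : ℝ) * (4 * B * Cw) * Zl D δ * (l1 (x - p) + 1) ^ 2 * Real.exp (-δ * l1 (x - p)) := by ring

/-- **THE TABLE PART OF THE BUBBLE FACTORISES**:
`Σ'_x Σ_a Σ'_z Σ_c tableTerm = Σ_a Σ_c Σ_ι Σ_κ sLeg ι κ A V p q a c · sLeg κ ι A W q p c a`. [folklore] -/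
theorem dsum_tableTerm (hA : Bdd A B) (hV : BiLoc V q q Cv δ) (hW : BiLoc W p p Cw δ) (hδ : 0 < δ) :
    ∑' x, ∑ a, ∑' z, ∑ c, tableTerm A V W p q x z a c
      = ∑ a : F, ∑ c : F, ∑ ι : Idx D, ∑ κ : Idx D, sLeg ι κ A V p q a c * sLeg κ ι A W q p c a := by
  -- inner series: finite sums out, then `tsum_tableOne_z`
  have hin : ∀ x a, ∑' z, ∑ c, tableTerm A V W p q x z a c
      = ∑ c, ∑ ι : Idx D, ∑ κ : Idx D, mono ι (x - p) * comp (dKer κ A) W q x c a * sLeg ι κ A V p q a c := by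
    intro x a
    have hs1 : ∀ c ι κ, Summable fun z => (mono ι (x - p) * comp (dKer ι A) V p z a c) * (mono κ (z - q) * comp (dKer κ A) W q x c a) :=
      fun c ι κ => summable_tableOne_z hA hV hW hδ ι κ x a c
    simp only [tableTerm]
    rw [Summable.tsum_finsetSum (fun c _ => summable_sum fun ι _ => summable_sum fun κ _ => hs1 c ι κ)]
    refine Finset.sum_congr rfl fun c _ => ?_
    rw [Summable.tsum_finsetSum (fun ι _ => summable_sum fun κ _ => hs1 c ι κ)]
    refine Finset.sum_congr rfl fun ι _ => ?_
    rw [Summable.tsum_finsetSum (fun κ _ => hs1 c ι κ)]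
    exact Finset.sum_congr rfl fun κ _ => tsum_tableOne_z ι κ x a c
  simp_rw [hin]
  -- outer series: finite sums out, then `tsum_mul_right`
  have hs2 : ∀ a c ι κ, Summable fun x => mono ι (x - p) * comp (dKer κ A) W q x c a * sLeg ι κ A V p q a c :=
    fun a c ι κ => (summable_legW_x hA hW hδ ι κ c a).mul_right _
  rw [Summable.tsum_finsetSum (fun a _ => summable_sum fun c _ => summable_sum fun ι _ => summable_sum fun κ _ => hs2 a c ι κ)]
  refine Finset.sum_congr rfl fun a _ => ?_
  rw [Summable.tsum_finsetSum (fun c _ => summable_sum fun ι _ => summable_sum fun κ _ => hs2 a c ι κ)]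
  refine Finset.sum_congr rfl fun c _ => ?_
  rw [Summable.tsum_finsetSum (fun ι _ => summable_sum fun κ _ => hs2 a c ι κ)]
  refine Finset.sum_congr rfl fun ι _ => ?_
  rw [Summable.tsum_finsetSum (fun κ _ => hs2 a c ι κ)]
  refine Finset.sum_congr rfl fun κ _ => ?_
  rw [tsum_mul_right, mul_comm]
  rfl

/-! ## §4 The pairing identity -/

/-- **THE TAYLOR PAIRING IDENTITY**: for a bounded leg `A`, `V` bi-localised at `(q, q)` and `W` at `(p, p)` (rate `δ > 0`),
`bubble A V W − Σ_a Σ_c Σ_ι Σ_κ sLeg ι κ A V p q a c · sLeg κ ι A W q p c a = Σ'_x Σ_a Σ'_z Σ_c remTerm A V W p q x z a c` — the bubble is a FINITE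
bilinear table of smeared difference legs (index `Idx D × Idx D` × fibre²) up to the explicit, absolutely convergent remainder series. [folklore] -/
theorem bubble_sub_table_eq (hA : Bdd A B) (hV : BiLoc V q q Cv δ) (hW : BiLoc W p p Cw δ) (hδ : 0 < δ) :
    bubble A V W - ∑ a : F, ∑ c : F, ∑ ι : Idx D, ∑ κ : Idx D, sLeg ι κ A V p q a c * sLeg κ ι A W q p c a
      = ∑' x, ∑ a, ∑' z, ∑ c, remTerm A V W p q x z a c := by
  rw [← dsum_tableTerm hA hV hW hδ, bubble_eq_tsum, sub_eq_iff_eq_add,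
    ← dsum_add (biLoc_remTerm hA hV hW hδ) (biLoc_tableTerm hA hV hW hδ) (by positivity)]
  refine tsum_congr fun x => Finset.sum_congr rfl fun a _ => tsum_congr fun z => Finset.sum_congr rfl fun c _ => ?_
  rw [integrand_split hA hV hW hδ x z a c, add_comm]

end Integrands

end Summit.QuantumFields.BalabanUV.Beta.FP.LegPairingTable

end
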